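import Literature.Probability.Percolation.TriLemma12
import Literature.Probability.Percolation.TriDiscreteDomainProofs
import Literature.Probability.Percolation.TriSepProbEstimates
import HarnessLib

/-!
# Khristoforov's separating sum rule (rediscovered): `Σᵢ fⁱ + Σⱼ h⁰(·, zⱼ)` is locally constant

Topic `Literature/Probability/Percolation`; family `crit-perc`. For a 3-marked discrete domain of
the triangular lattice (Bollobás–Riordan, *Percolation* (2006), Ch. 7 §7.2.4) write
`G(w) = f¹(w) + f²(w) + f³(w)` (sum of Smirnov's three separating probabilities at the face `w`,
(9) p. 180) and `K(w) = Σⱼ hⁱ(w, zⱼ)` (sum over the three neighbouring faces `zⱼ` of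
`hⁱ(w, z) = P(Eⁱ(z) ∖ Eⁱ(w))`, p. 180). Khristoforov (PhD thesis, Genève 2018, Part I, Prop. I.4(1)
with Prop. I.5 and eq. (4)) proves the exact identity `G + K ≡ 1` at `p = 1/2`
("`h₁(x) + h₂(x) + h₃(x) + t(x) ≡ 1` … due to the total probability formula" on the double cover
branched at `x`, `t` = the tripod probability, which his eq. (4) rewrites as the sum of the three
increments of one `h_j` over the edges at `x`). This file proves the part of that identity which
follows from the two facts of Bollobás–Riordan already in the tree — (10) p. 180,
`fⁱ(z) − fⁱ(w) = hⁱ(w, z) − hⁱ(z, w)` (`sepProb_sub_sepProb`), and Lemma 12 p. 180, the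
rotational symmetry of the `h`'s (`tri_sepDiffProb_rotate_holds`):

* `sum_sepDiffProb_oppFace_eq` — `K(w)` does not depend on the index `i`:
  `Σⱼ hⁱ(w, zⱼ) = Σⱼ h⁰(w, zⱼ)`;
* `sum_sepDiffProb_index_eq` — for a fixed neighbour `z` of `w`, `Σᵢ hⁱ(w, z) = K(w)`;
* `sum_sepProb_add_sum_sepDiffProb_eq_of_adj` — **`G + K` takes the same value at two adjacent
  inner faces** (summing (10) over `i`: `G(z) − G(w) = K(w) − K(z)`);
* `sum_sepProb_add_sum_sepDiffProb_eq_of_reflTransGen` — hence along every chain of adjacent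
  inner faces.

The value of the constant (`= 1`, Khristoforov's theorem; found independently as an exact
kernel relation "R*" on all 3-marked domains with `≤ 28` sites by the lane pcv-sawmu, 2026) is
NOT proved here: it needs the identification of `Eⁱ(w)` with a side of the chordal interface
(thesis p. 20), a separate file.

## References

* M. Khristoforov, *Low dimensional defects in percolation model*, PhD thesis, Université de
  Genève (2018), Thèse 5245, Part I §I.3.1: Prop. I.4(1) p. 17, eq. (4) p. 18, Prop. I.5 p. 18.
* M. Khristoforov, S. Smirnov, *Percolation and O(1) loop model*, arXiv:2111.15612 (2021), §2.
* B. Bollobás, O. Riordan, *Percolation*, Cambridge University Press (2006), Ch. 7 §7.2.4,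
  (9)–(10) and Lemma 12, p. 180.

## Mathlib / tree

Tree: `TriMarkedDomain.sepProb`, `sepDiffProb`, `oppFace`, `hexGraph_adj_oppFace`
(`TriDiscreteDomain.lean`); `sepProb_sub_sepProb` (`TriDiscreteDomainProofs.lean`);
`tri_sepDiffProb_rotate_holds` (`TriLemma12.lean`); `exists_oppFace_eq_of_hexGraph_adj`
(`TriSepProbEstimates.lean`). Mathlib: `Fin.sum_univ_three`, `Equiv.sum_comp`.
-/

noncomputable section

open Finset

namespace Literature.Probability.Percolation

namespace TriMarkedDomain

variable (D : TriMarkedDomain 3)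

/-- **Lemma 12 unfolded at one rotation**: for an inner face `w` and any `i, r`,
`hⁱ(w, z_{i+r}) = h⁰(w, z_r)` (Bollobás–Riordan 2006, Lemma 12 p. 180:
"`P(E¹(z₁) ∖ E¹(w)) = P(E²(z₂) ∖ E²(w)) = P(E³(z₃) ∖ E³(w))`"). [cite: BollobasRiordan2006, Ch. 7 Lemma 12 p. 180] -/
theorem sepDiffProb_oppFace_add_eq (w : LatticeModels.HexVertex)
    (hw : LatticeModels.hexFaceVertices w ⊆ D.verts) (i r : Fin 3) :
    D.sepDiffProb i w (oppFace w (i + r)) = D.sepDiffProb 0 w (oppFace w r) := by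
  obtain ⟨h01, h12⟩ := tri_sepDiffProb_rotate_holds D w r hw
  have e0 : (0 : Fin 3) + r = r := zero_add r
  rw [e0] at h01
  fin_cases i
  · simp
  · exact h01.symm
  · exact (h01.trans h12).symm

/-- **`K(w)` is index-free**: for an inner face `w` of a 3-marked discrete domain,
`Σⱼ hⁱ(w, zⱼ) = Σⱼ h⁰(w, zⱼ)` for every `i`, the sum running over the three neighbouring faces
`zⱼ = oppFace w j` (a consequence of Lemma 12 of Bollobás–Riordan 2006, p. 180; Khristoforov
2018 eq. (4) states the analogous index-freeness of the tripod term). [cite: BollobasRiordan2006, Ch. 7 Lemma 12 p. 180] -/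
theorem sum_sepDiffProb_oppFace_eq (w : LatticeModels.HexVertex)
    (hw : LatticeModels.hexFaceVertices w ⊆ D.verts) (i : Fin 3) :
    ∑ j : Fin 3, D.sepDiffProb i w (oppFace w j) = ∑ j : Fin 3, D.sepDiffProb 0 w (oppFace w j) := by
  have h : ∑ j : Fin 3, D.sepDiffProb i w (oppFace w j) =
      ∑ r : Fin 3, D.sepDiffProb i w (oppFace w (i + r)) :=
    (Equiv.sum_comp (Equiv.addLeft i) (fun j => D.sepDiffProb i w (oppFace w j))).symm
  rw [h]
  exact Finset.sum_congr rfl fun r _ => D.sepDiffProb_oppFace_add_eq w hw i r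

/-- **Summing the `h`'s over the index at a fixed neighbour gives `K(w)`**: for an inner face `w`
and its neighbour `z_r = oppFace w r`, `Σᵢ hⁱ(w, z_r) = Σⱼ h⁰(w, zⱼ)` (Lemma 12 of
Bollobás–Riordan 2006, p. 180, read as `hⁱ(w, z_r) = h⁰(w, z_{r-i})` and re-indexed). [cite: BollobasRiordan2006, Ch. 7 Lemma 12 p. 180] -/
theorem sum_sepDiffProb_index_eq (w : LatticeModels.HexVertex)
    (hw : LatticeModels.hexFaceVertices w ⊆ D.verts) (r : Fin 3) :
    ∑ i : Fin 3, D.sepDiffProb i w (oppFace w r) = ∑ j : Fin 3, D.sepDiffProb 0 w (oppFace w j) := by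
  have key : ∀ i : Fin 3, D.sepDiffProb i w (oppFace w r) = D.sepDiffProb 0 w (oppFace w (r - i)) := by
    intro i
    have e : r = i + (r - i) := by abel
    conv_lhs => rw [e]
    exact D.sepDiffProb_oppFace_add_eq w hw i (r - i)
  simp_rw [key]
  exact Equiv.sum_comp (Equiv.subLeft r) (fun j => D.sepDiffProb 0 w (oppFace w j))

/-- **The sum rule is locally constant (Khristoforov 2018, Prop. I.4(1), the part that follows
from Bollobás–Riordan's (10) and Lemma 12)**: for two ADJACENT inner faces `w` and
`z = oppFace w r` of a 3-marked discrete domain (all six vertices in `G`),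
`Σᵢ fⁱ(z) + Σⱼ h⁰(z, oppFace z j) = Σᵢ fⁱ(w) + Σⱼ h⁰(w, oppFace w j)`. Proof: summing (10),
`fⁱ(z) − fⁱ(w) = hⁱ(w, z) − hⁱ(z, w)`, over `i` gives `G(z) − G(w) = Σᵢ hⁱ(w, z) − Σᵢ hⁱ(z, w)
= K(w) − K(z)` by `sum_sepDiffProb_index_eq` at `w` and at `z` (`w` is an opposite face of `z`).
Khristoforov proves `G + K ≡ 1` ("`h₁(x) + h₂(x) + h₃(x) + t(x) ≡ 1`", thesis p. 17, with
Prop. I.5 and eq. (4) p. 18); the constant is not determined here. [cite: Khristoforov2018, Part I Prop. I.4(1) p. 17, eq. (4) and Prop. I.5 p. 18] -/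
theorem sum_sepProb_add_sum_sepDiffProb_eq_of_adj (w : LatticeModels.HexVertex) (r : Fin 3)
    (hw : LatticeModels.hexFaceVertices w ⊆ D.verts)
    (hz : LatticeModels.hexFaceVertices (oppFace w r) ⊆ D.verts) :
    ∑ i : Fin 3, D.sepProb i (oppFace w r) + ∑ j : Fin 3, D.sepDiffProb 0 (oppFace w r) (oppFace (oppFace w r) j) =
      ∑ i : Fin 3, D.sepProb i w + ∑ j : Fin 3, D.sepDiffProb 0 w (oppFace w j) := by
  set z := oppFace w r with hzdef
  -- `w` is a neighbour of `z`, hence an opposite face of `z`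
  have hadj : LatticeModels.hexGraph.Adj z w := (hexGraph_adj_oppFace w r).symm
  obtain ⟨r', hr'⟩ := exists_oppFace_eq_of_hexGraph_adj hadj
  -- (10) summed over `i`
  have h10 : ∑ i : Fin 3, D.sepProb i z - ∑ i : Fin 3, D.sepProb i w =
      ∑ i : Fin 3, D.sepDiffProb i w z - ∑ i : Fin 3, D.sepDiffProb i z w := by
    rw [← Finset.sum_sub_distrib, ← Finset.sum_sub_distrib]
    exact Finset.sum_congr rfl fun i _ => D.sepProb_sub_sepProb i w z
  have hKw : ∑ i : Fin 3, D.sepDiffProb i w z = ∑ j : Fin 3, D.sepDiffProb 0 w (oppFace w j) :=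
    D.sum_sepDiffProb_index_eq w hw r
  have hKz : ∑ i : Fin 3, D.sepDiffProb i z w = ∑ j : Fin 3, D.sepDiffProb 0 z (oppFace z j) := by
    rw [hr']
    exact D.sum_sepDiffProb_index_eq z hz r'
  rw [hKw, hKz] at h10
  linarith

/-- **`G + K` is constant along chains of adjacent inner faces**: if `z` is reached from `w` by
steps `F ↦ oppFace F r` through faces all of whose vertices lie in `G`, then
`Σᵢ fⁱ(z) + Σⱼ h⁰(z, oppFace z j) = Σᵢ fⁱ(w) + Σⱼ h⁰(w, oppFace w j)` (iterate
`sum_sepProb_add_sum_sepDiffProb_eq_of_adj`; Khristoforov 2018 Prop. I.4(1) gives the common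
value `1`). [cite: Khristoforov2018, Part I Prop. I.4(1) p. 17] -/
theorem sum_sepProb_add_sum_sepDiffProb_eq_of_reflTransGen {w z : LatticeModels.HexVertex}
    (h : Relation.ReflTransGen
      (fun F F' : LatticeModels.HexVertex => LatticeModels.hexFaceVertices F ⊆ D.verts ∧
        LatticeModels.hexFaceVertices F' ⊆ D.verts ∧ ∃ r : Fin 3, F' = oppFace F r) w z) :
    ∑ i : Fin 3, D.sepProb i z + ∑ j : Fin 3, D.sepDiffProb 0 z (oppFace z j) =
      ∑ i : Fin 3, D.sepProb i w + ∑ j : Fin 3, D.sepDiffProb 0 w (oppFace w j) := by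
  induction h with
  | refl => rfl
  | tail _ hstep ih =>
    obtain ⟨hF, hF', r, rfl⟩ := hstep
    rw [D.sum_sepProb_add_sum_sepDiffProb_eq_of_adj _ r hF hF', ih]

end TriMarkedDomain

end Literature.Probability.Percolation

end
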